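import Mathlib
import Summits.ValiantsHypothesis.ValiantsHypothesis.Theses.NewtonUnitEquations

/-!
# Sketch — crux `DissociatedFixedK` (stmt-ValiantsHypothesis-5907), crux-ideate round 1, ideator 2

First lemmas of the two crux idea cards `keyed-order-sweep` and `slab-recursion`, stated over
existing declarations.  PROVED here (0 sorries in their proofs): `sweepTop_exchange`,
`sweepTop_exchange'` (exchange monotonicity of the slope sweep), `sweep_boxTop_ncard_le` (the chain
count `≤ m (t-1) + 1` of box tops along one signed sweep) and `cube_lemma` (the pure cube lemma in
division-free Boolean form).  SORRIED signatures (they elaborate; proving them is the line):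
`exists_sweepTop_of_mem_extremePoints`, `thickness_keyed`, `slab_vertex`, `allAlive_proximity`,
`target_shape`.

Notation: `ι : (Fin 2 →₀ ℕ) → (Fin 2 → ℝ)` is the embedding used verbatim by the crux; the grid is
`Π_j A_j`; the coefficient tensor is `T(a) = Σ_i Π_j c i j (a j)` with `c i j e = coeff e (f i j)`.
-/

set_option linter.dupNamespace false

namespace Summit.ValiantsHypothesis.ValiantsHypothesis.Cruxes.DissociatedFixedK.IdeatorTwo

open scoped BigOperators

noncomputable section

/-- The embedding `ℕ² ↪ ℝ²` of exponent vectors used by the crux. -/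
def ι (e : Fin 2 →₀ ℕ) : Fin 2 → ℝ := fun i => ((e i : ℕ) : ℝ)

/-! ## Card `keyed-order-sweep`: keyed additive orders and the slope sweep -/

/-- The KEYED ORDER of the sweep: primary key `σ * (e 1 - μ * e 0)` (`σ = ±1`: the vertex is a
strict upper / lower support point, cf. the tree's `KPTT.EPRS.exists_support_of_convexIndependent`),
ties broken by the exponent itself in lex order.  Injective and additive, so its pull-back is an
ADDITIVE TOTAL ORDER on `ℕ²`: no generic direction is ever needed. -/
def sweepKey (σ μ : ℝ) (e : Fin 2 →₀ ℕ) : ℝ ×ₗ ℕ ×ₗ ℕ :=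
  toLex (σ * ((e 1 : ℝ) - μ * (e 0 : ℝ)), toLex (e 0, e 1))

/-- `a` is the top of the finite set `S ⊆ ℕ²` for the keyed order `(σ, μ)`. -/
def IsSweepTop (σ μ : ℝ) (S : Finset (Fin 2 →₀ ℕ)) (a : Fin 2 →₀ ℕ) : Prop :=
  a ∈ S ∧ ∀ e ∈ S, sweepKey σ μ e ≤ sweepKey σ μ a

theorem primary_le_of_key_le {σ μ : ℝ} {e a : Fin 2 →₀ ℕ} (h : sweepKey σ μ e ≤ sweepKey σ μ a) :
    σ * ((e 1 : ℝ) - μ * (e 0 : ℝ)) ≤ σ * ((a 1 : ℝ) - μ * (a 0 : ℝ)) := by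
  rcases (Prod.Lex.le_iff.1 h) with h1 | ⟨h1, -⟩
  · exact le_of_lt h1
  · exact le_of_eq h1

theorem eq_of_key_le_le {σ μ : ℝ} {e a : Fin 2 →₀ ℕ} (h : sweepKey σ μ e ≤ sweepKey σ μ a)
    (h' : sweepKey σ μ a ≤ sweepKey σ μ e) : e = a := by
  have heq : sweepKey σ μ e = sweepKey σ μ a := le_antisymm h h'
  unfold sweepKey at heq
  have h2 := congrArg (fun z => (ofLex (ofLex z).2)) heq
  simp only [ofLex_toLex] at h2
  obtain ⟨h0, h1⟩ := Prod.ext_iff.1 h2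
  ext i
  fin_cases i
  · exact h0
  · exact h1

/-- EXCHANGE MONOTONICITY OF THE SWEEP. -/
theorem sweepTop_exchange {S : Finset (Fin 2 →₀ ℕ)} {μ μ' : ℝ} (h : μ ≤ μ') {a a' : Fin 2 →₀ ℕ}
    (ha : IsSweepTop 1 μ S a) (ha' : IsSweepTop 1 μ' S a') : a' 0 < a 0 ∨ a' = a := by
  have P1 := primary_le_of_key_le (ha.2 a' ha'.1)
  have P2 := primary_le_of_key_le (ha'.2 a ha.1)
  simp only [one_mul] at P1 P2
  rcases lt_trichotomy (a' 0) (a 0) with hlt | heq | hgt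
  · exact Or.inl hlt
  · right
    have e0 : ((a' 0 : ℕ) : ℝ) = ((a 0 : ℕ) : ℝ) := by exact_mod_cast heq
    rw [e0] at P1 P2
    have e1 : ((a' 1 : ℕ) : ℝ) = ((a 1 : ℕ) : ℝ) := by linarith
    have e1' : a' 1 = a 1 := by exact_mod_cast e1
    ext i
    fin_cases i
    · exact heq
    · exact e1'
  · -- a' 0 > a 0 forces μ' = μ, and then the two tops coincide
    exfalso
    have hgt' : ((a 0 : ℕ) : ℝ) < ((a' 0 : ℕ) : ℝ) := by exact_mod_cast hgt
    have hμ : μ' = μ := by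
      by_contra hne
      have hlt : μ < μ' := lt_of_le_of_ne h (Ne.symm hne)
      nlinarith
    subst hμ
    have := eq_of_key_le_le (ha.2 a' ha'.1) (ha'.2 a ha.1)
    rw [this] at hgt
    exact lt_irrefl _ hgt

/-- unified exchange: along `μ`, `σ * x(top)` is non-increasing, equality of `x` forces equality. -/
theorem sweepTop_exchange' {σ : ℝ} (hσ : σ = 1 ∨ σ = -1) {S : Finset (Fin 2 →₀ ℕ)} {μ μ' : ℝ}
    (h : μ ≤ μ') {a a' : Fin 2 →₀ ℕ}
    (ha : IsSweepTop σ μ S a) (ha' : IsSweepTop σ μ' S a') :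
    σ * ((a' 0 : ℕ) : ℝ) < σ * ((a 0 : ℕ) : ℝ) ∨ a' = a := by
  have hσ2 : σ * σ = 1 := by rcases hσ with rfl | rfl <;> norm_num
  have P1 := primary_le_of_key_le (ha.2 a' ha'.1)
  have P2 := primary_le_of_key_le (ha'.2 a ha.1)
  have prod : (μ' - μ) * (σ * (((a' 0 : ℕ) : ℝ) - ((a 0 : ℕ) : ℝ))) ≤ 0 := by nlinarith [P1, P2]
  rcases lt_trichotomy (σ * ((a' 0 : ℕ) : ℝ)) (σ * ((a 0 : ℕ) : ℝ)) with hlt | heq | hgt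
  · exact Or.inl hlt
  · right
    have e0r : ((a' 0 : ℕ) : ℝ) = ((a 0 : ℕ) : ℝ) := by
      calc ((a' 0 : ℕ) : ℝ) = σ * σ * ((a' 0 : ℕ) : ℝ) := by rw [hσ2, one_mul]
        _ = σ * (σ * ((a' 0 : ℕ) : ℝ)) := by ring
        _ = σ * (σ * ((a 0 : ℕ) : ℝ)) := by rw [heq]
        _ = ((a 0 : ℕ) : ℝ) := by rw [← mul_assoc, hσ2, one_mul]
    have e0 : a' 0 = a 0 := by exact_mod_cast e0r
    rw [e0r] at P1 P2
    have e1r : σ * ((a' 1 : ℕ) : ℝ) = σ * ((a 1 : ℕ) : ℝ) := by nlinarith [P1, P2]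
    have e1r' : ((a' 1 : ℕ) : ℝ) = ((a 1 : ℕ) : ℝ) := by
      calc ((a' 1 : ℕ) : ℝ) = σ * (σ * ((a' 1 : ℕ) : ℝ)) := by rw [← mul_assoc, hσ2, one_mul]
        _ = σ * (σ * ((a 1 : ℕ) : ℝ)) := by rw [e1r]
        _ = ((a 1 : ℕ) : ℝ) := by rw [← mul_assoc, hσ2, one_mul]
    have e1 : a' 1 = a 1 := by exact_mod_cast e1r'
    ext i
    fin_cases i
    · exact e0
    · exact e1
  · exfalso
    have hμ : μ' = μ := by
      by_contra hne
      have hlt : μ < μ' := lt_of_le_of_ne h (Ne.symm hne)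
      nlinarith
    subst hμ
    have := eq_of_key_le_le (ha.2 a' ha'.1) (ha'.2 a ha.1)
    rw [this] at hgt
    exact lt_irrefl _ hgt

/-- CHAIN COUNT: the coordinatewise tops of a box along one signed sweep take ≤ m(t-1)+1 values. -/
theorem sweep_boxTop_ncard_le (m t : ℕ) (S : Fin m → Finset (Fin 2 →₀ ℕ))
    (hS : ∀ j, (S j).card ≤ t) (σ : ℝ) (hσ : σ = 1 ∨ σ = -1) :
    {a : Fin m → (Fin 2 →₀ ℕ) | ∃ μ : ℝ, ∀ j, IsSweepTop σ μ (S j) (a j)}.ncard ≤ m * (t - 1) + 1 := by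
  classical
  -- rank function
  let Φ : (Fin m → (Fin 2 →₀ ℕ)) → ℕ := fun a =>
    ∑ j, ((S j).filter fun e => σ * (((a j) 0 : ℕ) : ℝ) < σ * ((e 0 : ℕ) : ℝ)).card
  set X : Set (Fin m → (Fin 2 →₀ ℕ)) := {a | ∃ μ : ℝ, ∀ j, IsSweepTop σ μ (S j) (a j)} with hX
  -- Φ maps X into range (m (t-1) + 1)
  have hmaps : ∀ a ∈ X, Φ a ∈ (↑(Finset.range (m * (t - 1) + 1)) : Set ℕ) := by
    intro a ha
    obtain ⟨μ, hμ⟩ := ha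
    rw [Finset.coe_range, Set.mem_Iio, Nat.lt_succ_iff]
    have hle : ∀ j, ((S j).filter fun e => σ * (((a j) 0 : ℕ) : ℝ) < σ * ((e 0 : ℕ) : ℝ)).card
        ≤ t - 1 := by
      intro j
      have hsub : ((S j).filter fun e => σ * (((a j) 0 : ℕ) : ℝ) < σ * ((e 0 : ℕ) : ℝ))
          ⊆ (S j).erase (a j) := by
        intro e he
        rw [Finset.mem_filter] at he
        rw [Finset.mem_erase]
        refine ⟨?_, he.1⟩
        rintro rfl
        exact lt_irrefl _ he.2
      calc _ ≤ ((S j).erase (a j)).card := Finset.card_le_card hsub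
        _ = (S j).card - 1 := Finset.card_erase_of_mem (hμ j).1
        _ ≤ t - 1 := Nat.sub_le_sub_right (hS j) 1
    calc Φ a ≤ ∑ _j : Fin m, (t - 1) := Finset.sum_le_sum fun j _ => hle j
      _ = m * (t - 1) := by simp
  -- Φ is injective on X
  have hinj : Set.InjOn Φ X := by
    -- first: the one-directional strict monotonicity
    have hlt : ∀ a ∈ X, ∀ a' ∈ X, ∀ μ μ' : ℝ, μ ≤ μ' → (∀ j, IsSweepTop σ μ (S j) (a j)) →
        (∀ j, IsSweepTop σ μ' (S j) (a' j)) → a ≠ a' → Φ a < Φ a' := by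
      intro a _ a' _ μ μ' hμμ' ha ha' hne
      have hex : ∀ j, σ * (((a' j) 0 : ℕ) : ℝ) < σ * (((a j) 0 : ℕ) : ℝ) ∨ a' j = a j :=
        fun j => sweepTop_exchange' hσ hμμ' (ha j) (ha' j)
      obtain ⟨j₀, hj₀⟩ : ∃ j₀, a j₀ ≠ a' j₀ := by
        by_contra hall
        push Not at hall
        exact hne (funext hall)
      have hmono : ∀ j, ((S j).filter fun e => σ * (((a j) 0 : ℕ) : ℝ) < σ * ((e 0 : ℕ) : ℝ)) ⊆
          ((S j).filter fun e => σ * (((a' j) 0 : ℕ) : ℝ) < σ * ((e 0 : ℕ) : ℝ)) := by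
        intro j e he
        rw [Finset.mem_filter] at he ⊢
        refine ⟨he.1, ?_⟩
        rcases hex j with h1 | h1
        · exact h1.trans he.2
        · rw [h1]; exact he.2
      apply Finset.sum_lt_sum (fun j _ => Finset.card_le_card (hmono j))
      refine ⟨j₀, Finset.mem_univ _, Finset.card_lt_card ?_⟩
      refine (Finset.ssubset_iff_of_subset (hmono j₀)).2 ⟨a j₀, ?_, ?_⟩
      · rw [Finset.mem_filter]
        refine ⟨(ha j₀).1, ?_⟩
        rcases hex j₀ with h1 | h1
        · exact h1
        · exact absurd h1.symm hj₀
      · rw [Finset.mem_filter]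
        exact fun h => lt_irrefl _ h.2
    intro a haX a' haX' hΦ
    obtain ⟨μ, hμ⟩ := haX
    obtain ⟨μ', hμ'⟩ := haX'
    by_contra hne
    rcases le_total μ μ' with hle | hle
    · exact absurd hΦ (ne_of_lt (hlt a ⟨μ, hμ⟩ a' ⟨μ', hμ'⟩ μ μ' hle hμ hμ' hne))
    · exact absurd hΦ.symm (ne_of_lt (hlt a' ⟨μ', hμ'⟩ a ⟨μ, hμ⟩ μ' μ hle hμ' hμ (Ne.symm hne)))
  calc X.ncard ≤ (↑(Finset.range (m * (t - 1) + 1)) : Set ℕ).ncard :=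
        Set.ncard_le_ncard_of_injOn Φ hmaps hinj (Finset.finite_toSet _)
    _ = m * (t - 1) + 1 := by rw [Set.ncard_coe_finset, Finset.card_range]

/-- THE PURE CUBE LEMMA (division-free Boolean form). -/
theorem cube_lemma {R : Type*} [CommRing R] [IsDomain R] {s r : ℕ} (c : R) (hc : c ≠ 0)
    (x : Fin r → R) (φ : Fin r → Fin s → Bool → R) (hφ : ∀ i j, φ i j false ≠ 0)
    (h : ∀ y : Fin s → Bool, (∑ i, x i * ∏ j, φ i j (y j)) = if (∀ j, y j = true) then c else 0) :
    s + 1 ≤ r := by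
  induction s generalizing r c with
  | zero =>
    rcases Nat.eq_zero_or_pos r with rfl | hr
    · exfalso
      apply hc
      have := h (fun _ => true)
      simpa using this.symm
    · omega
  | succ s ih =>
    obtain ⟨r', rfl⟩ : ∃ r', r = r' + 1 := by
      rcases Nat.eq_zero_or_pos r with rfl | hr
      · exfalso
        apply hc
        have := h (fun _ => true)
        simpa using this.symm
      · exact ⟨r - 1, by omega⟩
    -- slice coordinate 0 with weights (α, β) chosen to kill term 0
    set α : R := φ 0 0 true with hα
    set β : R := -φ 0 0 false with hβ
    have hβ0 : β ≠ 0 := neg_ne_zero.2 (hφ 0 0)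
    let x' : Fin r' → R := fun i =>
      x (Fin.succ i) * (α * φ (Fin.succ i) 0 false + β * φ (Fin.succ i) 0 true)
    let φ' : Fin r' → Fin s → Bool → R := fun i j => φ (Fin.succ i) j.succ
    have key : ∀ y' : Fin s → Bool,
        (∑ i, x' i * ∏ j, φ' i j (y' j)) = if (∀ j, y' j = true) then β * c else 0 := by
      intro y'
      have h0 := h (Fin.cons false y')
      have h1 := h (Fin.cons true y')
      simp only [Fin.prod_univ_succ, Fin.cons_zero, Fin.cons_succ] at h0 h1
      have hc0 : ¬ (∀ j : Fin (s + 1), (Fin.cons false y' : Fin (s + 1) → Bool) j = true) := by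
        intro hall
        have := hall 0
        simp at this
      rw [if_neg hc0] at h0
      have hc1 : (∀ j : Fin (s + 1), (Fin.cons true y' : Fin (s + 1) → Bool) j = true) ↔
          (∀ j, y' j = true) := by
        rw [Fin.forall_fin_succ]
        simp
      rw [if_congr hc1 rfl rfl] at h1
      -- combine: α * h0 + β * h1
      have comb : α * (∑ i, x i * (φ i 0 false * ∏ j, φ i j.succ (y' j))) +
          β * (∑ i, x i * (φ i 0 true * ∏ j, φ i j.succ (y' j))) =
            ∑ i, x' i * ∏ j, φ' i j (y' j) := by
        rw [Finset.mul_sum, Finset.mul_sum, ← Finset.sum_add_distrib, Fin.sum_univ_succ]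
        have hz : α * (x 0 * (φ 0 0 false * ∏ j, φ 0 j.succ (y' j))) +
            β * (x 0 * (φ 0 0 true * ∏ j, φ 0 j.succ (y' j))) = 0 := by
          rw [hα, hβ]; ring
        rw [hz, zero_add]
        refine Finset.sum_congr rfl fun i _ => ?_
        simp only [x', φ']
        ring
      rw [← comb, h0, h1, mul_zero, zero_add]
      split_ifs <;> simp
    have hφ' : ∀ i j, φ' i j false ≠ 0 := fun i j => hφ _ _
    have := ih (β * c) (mul_ne_zero hβ0 hc) x' φ' hφ' key
    omega


/-- EXPOSEDNESS IN SWEEP FORM (to prove; variant of the tree's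
`KPTT.EPRS.exists_support_of_convexIndependent`, against ALL points of `P`, not only the other
vertices — same Hahn–Banach proof from `p ∉ convexHull (P \ {p})`,
`Convex.mem_extremePoints_iff_mem_sdiff_convexHull_sdiff`): an extreme point of the hull of a finite
planar set is the unique keyed-order maximum of the set for some `(σ, μ)`, `σ = ±1`. -/
theorem exists_sweepTop_of_mem_extremePoints (P : Finset (Fin 2 →₀ ℕ)) {p : Fin 2 →₀ ℕ} (hp : p ∈ P)
    (hext : ι p ∈ Set.extremePoints ℝ (convexHull ℝ (ι '' (P : Set (Fin 2 →₀ ℕ))))) :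
    ∃ σ μ : ℝ, (σ = 1 ∨ σ = -1) ∧ ∀ e ∈ P, e ≠ p → sweepKey σ μ e < sweepKey σ μ p := by
  sorry

/-- THICKNESS FOR A KEYED ORDER (to prove; the route-review cube argument restated tie-free): if `b`
is the keyed-order top of the survivors `{a ∈ Π A_j : T a ≠ 0}`, `I` its alive pattern and `aI` the
coordinatewise keyed-order top of the alive box, then `b` and `aI` differ in at most `k - 1`
coordinates. -/
theorem thickness_keyed (k m : ℕ) (A : Fin m → Finset (Fin 2 →₀ ℕ))
    (c : Fin k → (j : Fin m) → (Fin 2 →₀ ℕ) → ℂ) (σ μ : ℝ)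
    (b : Fin m → (Fin 2 →₀ ℕ)) (hb : ∀ j, b j ∈ A j)
    (hTb : (∑ i, ∏ j, c i j (b j)) ≠ 0)
    (htop : ∀ a : Fin m → (Fin 2 →₀ ℕ), (∀ j, a j ∈ A j) → (∑ i, ∏ j, c i j (a j)) ≠ 0 →
      sweepKey σ μ (∑ j, a j) ≤ sweepKey σ μ (∑ j, b j))
    (aI : Fin m → (Fin 2 →₀ ℕ))
    (haI : ∀ j, IsSweepTop σ μ
      ((A j).filter fun e => ∀ i, (∏ j', c i j' (b j')) ≠ 0 → c i j e ≠ 0) (aI j)) :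
    (Finset.univ.filter fun j => b j ≠ aI j).card + 1 ≤ k := by
  sorry

/-! ## Card `slab-recursion`: dead products recurse to `k - 1`, alive vertices are cube-close -/

/-- The slab instance: factor `j₀` of every product restricted to the zeros of `f i₀ j₀` inside
`A j₀` (all other factors unchanged); the product `i₀` itself then vanishes and is dropped. -/
def slabFactor {k m : ℕ} (A : Fin m → Finset (Fin 2 →₀ ℕ))
    (f : Fin (k + 1) → Fin m → MvPolynomial (Fin 2) ℂ) (i₀ : Fin (k + 1)) (j₀ : Fin m)
    (i : Fin k) (j : Fin m) : MvPolynomial (Fin 2) ℂ :=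
  if j = j₀ then
    ∑ e ∈ (A j₀).filter (fun e => MvPolynomial.coeff e (f i₀ j₀) = 0),
      MvPolynomial.monomial e (MvPolynomial.coeff e (f (i₀.succAbove i) j₀))
  else f (i₀.succAbove i) j

/-- SLAB LEMMA — FIRST LEMMA of card `slab-recursion` (to prove): in the dissociated regime a hull
vertex `ι (Σ_j b_j)` of `Newt(Σ_{i ≤ k} Π_j f_ij)` at which product `i₀` is dead in coordinate `j₀`
is a hull vertex of the `k`-term slab instance — its support is `σ(supp T ∩ slab) ⊆ supp`, so its
hull sits inside the big hull and still contains the point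
(`inter_extremePoints_subset_extremePoints_of_subset`).  No order, no genericity, no cells. -/
theorem slab_vertex (k m : ℕ) (A : Fin m → Finset (Fin 2 →₀ ℕ))
    (f : Fin (k + 1) → Fin m → MvPolynomial (Fin 2) ℂ)
    (hsupp : ∀ i j, (f i j).support ⊆ A j)
    (hinj : ∀ a b : Fin m → (Fin 2 →₀ ℕ), (∀ j, a j ∈ A j) → (∀ j, b j ∈ A j) →
      ∑ j, a j = ∑ j, b j → a = b)
    (i₀ : Fin (k + 1)) (j₀ : Fin m) (b : Fin m → (Fin 2 →₀ ℕ)) (hb : ∀ j, b j ∈ A j)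
    (hdead : MvPolynomial.coeff (b j₀) (f i₀ j₀) = 0)
    (hvert : ι (∑ j, b j) ∈
      Set.extremePoints ℝ (convexHull ℝ (ι '' ((∑ i, ∏ j, f i j).support : Set (Fin 2 →₀ ℕ))))) :
    ι (∑ j, b j) ∈ Set.extremePoints ℝ (convexHull ℝ
      (ι '' ((∑ i : Fin k, ∏ j, slabFactor A f i₀ j₀ i j).support : Set (Fin 2 →₀ ℕ)))) := by
  sorry

/-- ALL-ALIVE PROXIMITY (to prove, from `cube_lemma`): if every one of the `k + 1` products is alive
at the keyed-order top survivor `b`, then `b` differs from the keyed-order top `a` of the COMMON box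
`Π_j {e ∈ A j : ∀ i, c i j e ≠ 0}` in at most `k` coordinates.  (The `2^J` sub-box spanned by `a`
and `b` lies in the grid, is strictly above `b` off `b` — additivity of the key —, so `T` restricted
to it is `T(b) • δ_b` with every term rank-one and alive at `a`: `cube_lemma`.) -/
theorem allAlive_proximity (k m : ℕ) (A : Fin m → Finset (Fin 2 →₀ ℕ))
    (c : Fin (k + 1) → (j : Fin m) → (Fin 2 →₀ ℕ) → ℂ) (σ μ : ℝ)
    (b : Fin m → (Fin 2 →₀ ℕ)) (hb : ∀ j, b j ∈ A j) (halive : ∀ i j, c i j (b j) ≠ 0)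
    (hTb : (∑ i, ∏ j, c i j (b j)) ≠ 0)
    (htop : ∀ a : Fin m → (Fin 2 →₀ ℕ), (∀ j, a j ∈ A j) → (∑ i, ∏ j, c i j (a j)) ≠ 0 →
      sweepKey σ μ (∑ j, a j) ≤ sweepKey σ μ (∑ j, b j))
    (a : Fin m → (Fin 2 →₀ ℕ))
    (ha : ∀ j, IsSweepTop σ μ ((A j).filter fun e => ∀ i, c i j e ≠ 0) (a j)) :
    (Finset.univ.filter fun j => b j ≠ a j).card ≤ k := by
  sorry

/-- THE RECURSION it feeds (shape only; to prove last): with `V k` the crux's vertex count maximised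
over instances with parameters `(m, t)`, `V (k+1) ≤ (k+1) · m · V k + 4 (m (t-1) + 1) (m t + 1)^k`
(slab vertices + all-alive vertices: two signed sweeps, chain count, `≤ k` re-chosen coordinates with
`≤ t` values each) and `V 0 = 0`; hence `V k ≤ (m t + 2)^(C k)` with an explicit `C k` — the crux. -/
theorem target_shape :
    Summit.ValiantsHypothesis.ValiantsHypothesis.Theses.NewtonUnitEquations.DissociatedFixedK := by
  sorry

end

end Summit.ValiantsHypothesis.ValiantsHypothesis.Cruxes.DissociatedFixedK.IdeatorTwo
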